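import Literature.NumberTheory.Adeles.FiniteAdeleLatticeOfGL
import HarnessLib

/-!
# `Λ_a = γ ℤⁿ`, `GL_n(𝔸_{ℚ,f}) = GL_n(ℚ) · GL_n(ℤ̂)`, and the lattice dictionary `GL_n(𝔸_{ℚ,f})/GL_n(ℤ̂) ≃ {full lattices}`

Topic `Literature/NumberTheory/Adeles`; namespace `Literature.NumberTheory.Adeles`.  THEOREMS ONLY (no definition, no named
fact, no instance, no `sorry`), over the carrier ★ `FiniteAdeleLatticeOfGL` (`latticeOfGL a = Λ_a = ℚⁿ ∩ a ℤ̂ⁿ`).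

* `exists_eq_latticeOfGL_map_of_sandwiched` — **a full lattice of `ℚⁿ` is `γ ℤⁿ`** for some `γ ∈ GL_n(ℚ)` (full-rank subgroups of
  `ℚⁿ` are free of rank `n`: ★ `nonempty_basis_of_sandwiched`, plus invertibility of the basis matrix);
* `exists_latticeOfGL_eq_latticeOfGL_map` — `Λ_a = γ ℤⁿ`;
* `inv_mul_mem_of_latticeOfGL_eq`, **`exists_map_mul_eq` — `GL_n(𝔸_{ℚ,f}) = GL_n(ℚ) · GL_n(ℤ̂)`** (class number one of `GL_n` over
  `ℚ`; strong approximation `𝔸_{ℚ,f} = ℚ + N ℤ̂`, ★ `exists_rat_add_natCast_mul`);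
* **`latticeOfGL_eq_latticeOfGL_iff` — `Λ_a = Λ_b ↔ a⁻¹ b ∈ GL_n(ℤ̂)`**, i.e. `a ↦ Λ_a` identifies `GL_n(𝔸_{ℚ,f})/GL_n(ℤ̂)` with
  the set of full lattices of `ℚⁿ`, `GL_n(ℚ)`-equivariantly ([PlatonovRapinchuk1994] §8.1; [Milne2005ShimuraVarieties]
  §6 Thm. 6.11 p. 74 and the `V(ℤ̂)`-lattice description p. 75);
* `latticeOfGL_map_mul_eq_iff` — the stabiliser: `γ • Λ_a = Λ_a ↔ a⁻¹ γ a ∈ GL_n(ℤ̂)` («`Γ_g = gKg⁻¹ ∩ G(ℚ)⁺`»,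
  [Milne2005ShimuraVarieties] Lemma 5.13 p. 57).

Cell `hodgecm-mathlib` (D-0151), #60 road leaf R60-19 (file 2 of 3).  Banked generic leaf; HC_CM is proved only modulo the printed
citations until rung 0 closes; no floor change.

## References
* [Milne2005ShimuraVarieties] J. S. Milne, *Introduction to Shimura varieties* (2005; 2017 revision pages), §4 Thm. 4.16 and
  Rem. 4.17 (a) p. 48 (strong approximation; `ℚ^×` is not dense in `𝔸_f^×`), §5 Lemma 5.13 p. 57 (`Γ_g = gKg⁻¹ ∩ G(ℚ)⁺`),
  §6 Thm. 6.11 p. 74 (`T_f(A) = H₁(A, ℤ) ⊗ ℤ̂`, `V(𝔸_f) → V_f(A)`) and p. 75 (`V(ℤ̂)`, `K(N)`, `Γ(N)`).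
* [PlatonovRapinchuk1994] V. Platonov, A. Rapinchuk, *Algebraic groups and number theory* (1994), §8.1 (class number of `GL_n` over `ℚ`).
* [Deligne1971TravauxShimura] P. Deligne, *Travaux de Shimura* (1971), 4.16–4.20 pp. 150–152.
-/

set_option autoImplicit false

noncomputable section

open scoped Matrix
open NumberField IsDedekindDomain Matrix
open Literature.NumberTheory.Automorphic (integralFiniteAdeles mem_integralFiniteAdeles_iff)
open Literature.AlgebraicGeometry.ModuliOfAbelianVarieties (finAdeleQ)

namespace Literature.NumberTheory.Adeles

variable {n : Type} [Fintype n] [DecidableEq n]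

/-! ### §0. Plumbing (private copies of the carrier file's bookkeeping identities) -/

omit [DecidableEq n] in
/-- Integral matrices send integral vectors to integral vectors. [folklore] -/
private theorem mulVec_apply_mem_integralFiniteAdeles {M : Matrix n n finAdeleQ}
    (hM : ∀ i j, M i j ∈ integralFiniteAdeles ℚ) {y : n → finAdeleQ}
    (hy : ∀ j, y j ∈ integralFiniteAdeles ℚ) (i : n) : (M *ᵥ y) i ∈ integralFiniteAdeles ℚ := by
  rw [Matrix.mulVec, dotProduct]
  exact sum_mem fun j _ => mul_mem (hM i j) (hy j)
/-- The adelic image of `γ⁻¹` is the inverse of the adelic image of `γ` (as matrices). [folklore] -/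
private theorem coe_generalLinearGroup_map_inv (γ : GL n ℚ) :
    (((Matrix.GeneralLinearGroup.map (algebraMap ℚ finAdeleQ) γ)⁻¹ : GL n finAdeleQ) : Matrix n n finAdeleQ) =
      ((γ⁻¹ : GL n ℚ) : Matrix n n ℚ).map (algebraMap ℚ finAdeleQ) := by
  rw [← map_inv]; rfl
omit [DecidableEq n] in
/-- `f ∘ (M q) = (M.map f) (f ∘ q)` for the diagonal embedding `f : ℚ → 𝔸_{ℚ,f}`. [folklore] -/
private theorem algebraMap_comp_mulVec (M : Matrix n n ℚ) (q : n → ℚ) :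
    (⇑(algebraMap ℚ finAdeleQ) ∘ (M *ᵥ q)) = M.map (algebraMap ℚ finAdeleQ) *ᵥ (⇑(algebraMap ℚ finAdeleQ) ∘ q) := by
  funext i
  exact RingHom.map_mulVec (algebraMap ℚ finAdeleQ) M q i
omit [Fintype n] in
/-- The diagonal embedding of a standard vector is the standard vector. [folklore] -/
private theorem algebraMap_comp_single (j : n) :
    (⇑(algebraMap ℚ finAdeleQ) ∘ (Pi.single j 1 : n → ℚ)) = (Pi.single j 1 : n → finAdeleQ) := by
  classical
  funext k
  by_cases hk : k = j
  · subst hk; simp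
  · simp [hk]
/-- The `(i, j)` entry of `M` is the `i`-th coordinate of `M eⱼ`. [folklore] -/
private theorem matrix_apply_eq_mulVec_single (M : Matrix n n finAdeleQ) (i j : n) :
    M i j = (M *ᵥ (Pi.single j 1 : n → finAdeleQ)) i := by
  classical
  simp [Matrix.mulVec, dotProduct, Pi.single_apply]

/-! ### §1. Every full lattice is `γ ℤⁿ`; `Λ_a = γ ℤⁿ` -/

/-- **Full-rank subgroups of `ℚⁿ` are free of rank `n`** (sandwich form with a denominator): if `N eᵢ ∈ Λ` for all `i`
and `N Λ ⊆ ℤⁿ` (`N ≥ 1`), then `Λ` has a `ℤ`-basis indexed by `n` (scale by `N` into `ℤⁿ` and use ★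
`nonempty_basis_of_sandwiched`). [cite: PlatonovRapinchuk1994, §8.1] -/
theorem nonempty_basis_of_sandwiched' (Λ : Submodule ℤ (n → ℚ)) {N : ℕ} (hN : N ≠ 0)
    (hstd : ∀ i, ((N : ℚ) • Pi.single i 1 : n → ℚ) ∈ Λ)
    (hint : ∀ q ∈ Λ, ∀ i, ∃ z : ℤ, (z : ℚ) = N * q i) :
    Nonempty (Module.Basis n ℤ Λ) := by
  classical
  have hNQ : (N : ℚ) ≠ 0 := Nat.cast_ne_zero.mpr hN
  -- the scaled lattice `Λ' = N Λ ⊆ ℤⁿ`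
  let sc : (n → ℚ) →ₗ[ℤ] (n → ℚ) := (((N : ℚ) • (1 : Matrix n n ℚ)).mulVecLin).restrictScalars ℤ
  have hsc : ∀ q : n → ℚ, sc q = (N : ℚ) • q := fun q => by
    simp only [sc, LinearMap.restrictScalars_apply, Matrix.mulVecLin_apply, Matrix.smul_mulVec,
      Matrix.one_mulVec]
  have hsc_inj : Function.Injective sc := fun q q' h => by
    rw [hsc, hsc] at h
    exact smul_right_injective _ hNQ h
  let Λ' : Submodule ℤ (n → ℚ) := Λ.map sc
  have hstd' : ∀ i, (((N * N : ℕ) : ℚ) • Pi.single i 1 : n → ℚ) ∈ Λ' := fun i => by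
    refine Submodule.mem_map.mpr ⟨_, hstd i, ?_⟩
    rw [hsc, smul_smul, Nat.cast_mul]
  have hint' : ∀ q ∈ Λ', ∀ i, ∃ z : ℤ, (z : ℚ) = q i := fun q hq i => by
    obtain ⟨p, hp, rfl⟩ := Submodule.mem_map.mp hq
    obtain ⟨z, hz⟩ := hint p hp i
    exact ⟨z, by rw [hz, hsc, Pi.smul_apply, smul_eq_mul]⟩
  obtain ⟨b'⟩ := nonempty_basis_of_sandwiched Λ' (mul_ne_zero hN hN) hstd' hint'
  let e : Λ ≃ₗ[ℤ] Λ' := Submodule.equivMapOfInjective sc hsc_inj Λ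
  exact ⟨b'.map e.symm⟩

/-- **A full lattice of `ℚⁿ` is `γ ℤⁿ` for some `γ ∈ GL_n(ℚ)`**: if `N eᵢ ∈ Λ` for all `i` and `N Λ ⊆ ℤⁿ`
(`N ≥ 1`), then `Λ = Λ_γ = γ ℤⁿ` with `γ` the matrix of a `ℤ`-basis of `Λ` (full-rank subgroups of `ℚⁿ` are free of
rank `n`). [cite: PlatonovRapinchuk1994, §8.1] -/
theorem exists_eq_latticeOfGL_map_of_sandwiched (Λ : Submodule ℤ (n → ℚ)) {N : ℕ} (hN : N ≠ 0)
    (hstd : ∀ i, ((N : ℚ) • Pi.single i 1 : n → ℚ) ∈ Λ)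
    (hint : ∀ q ∈ Λ, ∀ i, ∃ z : ℤ, (z : ℚ) = N * q i) :
    ∃ γ : GL n ℚ, Λ = latticeOfGL (Matrix.GeneralLinearGroup.map (algebraMap ℚ finAdeleQ) γ) := by
  classical
  have hNQ : (N : ℚ) ≠ 0 := Nat.cast_ne_zero.mpr hN
  obtain ⟨b⟩ := nonempty_basis_of_sandwiched' Λ hN hstd hint
  -- the basis matrix `B` and its inverse
  let B : Matrix n n ℚ := fun i j => ((b j : Λ) : n → ℚ) i
  have hBspan : ∀ q ∈ Λ, ∃ z : n → ℤ, q = B *ᵥ fun j => (z j : ℚ) := by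
    intro q hq
    refine ⟨fun j => b.repr ⟨q, hq⟩ j, ?_⟩
    have h := b.sum_repr ⟨q, hq⟩
    have h' : q = ∑ j, (b.repr ⟨q, hq⟩ j : ℤ) • ((b j : Λ) : n → ℚ) := by
      have := congrArg (fun x : Λ => (x : n → ℚ)) h
      simpa only [Submodule.coe_sum, Submodule.coe_smul_of_tower] using this.symm
    funext i
    rw [congrFun h' i, Finset.sum_apply, Matrix.mulVec, dotProduct]
    refine Finset.sum_congr rfl fun j _ => ?_
    rw [Pi.smul_apply, zsmul_eq_mul, mul_comm]
  have hBmem : ∀ z : n → ℤ, (B *ᵥ fun j => (z j : ℚ)) ∈ Λ := fun z => by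
    have : (B *ᵥ fun j => (z j : ℚ)) = ∑ j, (z j : ℤ) • ((b j : Λ) : n → ℚ) := by
      funext i
      rw [Finset.sum_apply, Matrix.mulVec, dotProduct]
      refine Finset.sum_congr rfl fun j _ => ?_
      rw [Pi.smul_apply, zsmul_eq_mul, mul_comm]
    rw [this]
    exact Submodule.sum_mem _ fun j _ => Submodule.smul_mem _ _ (b j).2
  choose zcol hzcol using fun j => hBspan _ (hstd j)
  let Zc : Matrix n n ℚ := fun i j => (zcol j i : ℚ)
  have hBZ : B * Zc = (N : ℚ) • (1 : Matrix n n ℚ) := by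
    ext i j
    have h := congrFun (hzcol j) i
    rw [Pi.smul_apply, smul_eq_mul] at h
    rw [Matrix.mul_apply, Matrix.smul_apply, smul_eq_mul, Matrix.one_apply, Pi.single_apply] at *
    rw [h, Matrix.mulVec, dotProduct]
  let Binv : Matrix n n ℚ := (N : ℚ)⁻¹ • Zc
  have hBBinv : B * Binv = 1 := by
    rw [Matrix.mul_smul, hBZ, smul_smul, inv_mul_cancel₀ hNQ, one_smul]
  have hBinvB : Binv * B = 1 := mul_eq_one_comm.mp hBBinv
  let γ : GL n ℚ := ⟨B, Binv, hBBinv, hBinvB⟩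
  refine ⟨γ, ?_⟩
  ext q
  rw [mem_latticeOfGL_map_iff_exists]
  exact ⟨hBspan q, fun ⟨z, hz⟩ => hz ▸ hBmem z⟩

/-- **`Λ_a = γ ℤⁿ` for some `γ ∈ GL_n(ℚ)`** (every `Λ_a` is a full lattice, hence free of rank `n` with an invertible
basis matrix). [cite: PlatonovRapinchuk1994, §8.1] [cite: Milne2005ShimuraVarieties, §6 p. 75] -/
theorem exists_latticeOfGL_eq_latticeOfGL_map (a : GL n finAdeleQ) :
    ∃ γ : GL n ℚ, latticeOfGL a = latticeOfGL (Matrix.GeneralLinearGroup.map (algebraMap ℚ finAdeleQ) γ) := by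
  obtain ⟨N, hN, hNa, hNa'⟩ := exists_nat_mul_entries_mem a
  exact exists_eq_latticeOfGL_map_of_sandwiched (latticeOfGL a) hN
    (natCast_smul_single_mem_latticeOfGL hNa') fun q hq => exists_int_cast_eq_natCast_mul_of_mem_latticeOfGL hNa hq

/-- **`Λ_a` is free of rank `n` over `ℤ`**: it has a `ℤ`-basis indexed by `n` (a full lattice of `ℚⁿ`).
[cite: PlatonovRapinchuk1994, §8.1] -/
theorem nonempty_basis_latticeOfGL (a : GL n finAdeleQ) : Nonempty (Module.Basis n ℤ (latticeOfGL a)) := by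
  obtain ⟨N, hN, hNa, hNa'⟩ := exists_nat_mul_entries_mem a
  exact nonempty_basis_of_sandwiched' (latticeOfGL a) hN
    (natCast_smul_single_mem_latticeOfGL hNa') fun q hq => exists_int_cast_eq_natCast_mul_of_mem_latticeOfGL hNa hq

/-! ### §2. `GL_n(𝔸_{ℚ,f}) = GL_n(ℚ) · GL_n(ℤ̂)` and the orbit dictionary -/

/-- **If `Λ_a = γ ℤⁿ` then `γ⁻¹ a ∈ GL_n(ℤ̂)`.**  Integrality of `a⁻¹ γ`: the columns `γ eⱼ` lie in `Λ_γ = Λ_a`.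
Integrality of `γ⁻¹ a`: write a column `x` of `a` as `x = k + N y` with `k ∈ ℚⁿ`, `y ∈ ℤ̂ⁿ` and `N` killing the
denominators of `a⁻¹` and `γ⁻¹` (strong approximation `𝔸_{ℚ,f} = ℚ + N ℤ̂`); then `k ∈ Λ_a = γ ℤⁿ`, so `γ⁻¹ k ∈ ℤⁿ`, and
`γ⁻¹ N y ∈ ℤ̂ⁿ`. [cite: PlatonovRapinchuk1994, §8.1] [cite: Milne2005ShimuraVarieties, §4 Thm. 4.16 and Rem. 4.17 (a) p. 48] -/
theorem inv_mul_mem_of_latticeOfGL_eq {a : GL n finAdeleQ} {γ : GL n ℚ}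
    (h : latticeOfGL a = latticeOfGL (Matrix.GeneralLinearGroup.map (algebraMap ℚ finAdeleQ) γ)) :
    (Matrix.GeneralLinearGroup.map (algebraMap ℚ finAdeleQ) γ)⁻¹ * a ∈
      ((integralFiniteAdeles ℚ).matrix.toSubmonoid.units : Subgroup (GL n finAdeleQ)) := by
  classical
  set γA : GL n finAdeleQ := Matrix.GeneralLinearGroup.map (algebraMap ℚ finAdeleQ) γ with hγA
  rw [mem_units_matrix_integralFiniteAdeles_iff]
  refine ⟨fun i j => ?_, fun i j => ?_⟩
  · -- `γ⁻¹ a` is integral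
    obtain ⟨N₁, hN₁, -, hN₁'⟩ := exists_nat_mul_entries_mem a
    obtain ⟨N₂, hN₂, -, hN₂'⟩ := exists_nat_mul_entries_mem γA
    have hN : N₁ * N₂ ≠ 0 := mul_ne_zero hN₁ hN₂
    -- the column `x = a eⱼ`, split as `k + N y`
    set x : n → finAdeleQ := (a : Matrix n n finAdeleQ) *ᵥ (Pi.single j 1 : n → finAdeleQ) with hx
    choose k y hy hxy using fun l => exists_rat_add_natCast_mul (N₁ * N₂) hN (x l)
    have hx_split : x = (⇑(algebraMap ℚ finAdeleQ) ∘ k) + fun l => ((N₁ * N₂ : ℕ) : finAdeleQ) * y l := funext hxy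
    -- `a⁻¹ (N y)` and `γ⁻¹ (N y)` are integral
    have hNy : ∀ (M : Matrix n n finAdeleQ) (N' : ℕ),
        (∀ i j, (N' : finAdeleQ) * M i j ∈ integralFiniteAdeles ℚ) → ∀ (N'' : ℕ) (i),
          (M *ᵥ fun l => ((N' * N'' : ℕ) : finAdeleQ) * y l) i ∈ integralFiniteAdeles ℚ := by
      intro M N' hM N'' i
      rw [Matrix.mulVec, dotProduct]
      refine sum_mem fun l _ => ?_
      rw [Nat.cast_mul, show M i l * ((N' : finAdeleQ) * (N'' : finAdeleQ) * y l) =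
        ((N' : finAdeleQ) * M i l) * ((N'' : finAdeleQ) * y l) by ring]
      exact mul_mem (hM i l) (mul_mem (natCast_mem _ N'') (hy l))
    have hay : ∀ i, (((a⁻¹ : GL n finAdeleQ) : Matrix n n finAdeleQ) *ᵥ
        fun l => ((N₁ * N₂ : ℕ) : finAdeleQ) * y l) i ∈ integralFiniteAdeles ℚ := hNy _ N₁ hN₁' N₂
    have hγy : ∀ i, (((γA⁻¹ : GL n finAdeleQ) : Matrix n n finAdeleQ) *ᵥ
        fun l => ((N₁ * N₂ : ℕ) : finAdeleQ) * y l) i ∈ integralFiniteAdeles ℚ := by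
      intro i
      have := hNy _ N₂ hN₂' N₁ i
      rwa [mul_comm N₂ N₁] at this
    -- `k ∈ Λ_a`
    have hk : k ∈ latticeOfGL a := by
      intro i
      have hk' : (⇑(algebraMap ℚ finAdeleQ) ∘ k) = x - fun l => ((N₁ * N₂ : ℕ) : finAdeleQ) * y l := by
        rw [hx_split, add_sub_cancel_right]
      rw [hk', Matrix.mulVec_sub, Pi.sub_apply, hx, Matrix.mulVec_mulVec, ← Units.val_mul, inv_mul_cancel,
        Units.val_one, Matrix.one_mulVec]
      refine sub_mem ?_ (hay i)
      by_cases hij : i = j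
      · subst hij; simp
      · simp [hij]
    -- hence `γ⁻¹ k ∈ ℤⁿ`
    rw [h] at hk
    have hγk : ∀ i, (((γA⁻¹ : GL n finAdeleQ) : Matrix n n finAdeleQ) *ᵥ (⇑(algebraMap ℚ finAdeleQ) ∘ k)) i ∈
        integralFiniteAdeles ℚ := by
      intro i
      obtain ⟨z, hz⟩ := (mem_latticeOfGL_map_iff γ k).mp hk i
      rw [hγA, coe_generalLinearGroup_map_inv, ← algebraMap_comp_mulVec, Function.comp_apply, ← hz]
      exact algebraMap_intCast_mem_integralFiniteAdeles z
    -- assemble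
    rw [Units.val_mul, matrix_apply_eq_mulVec_single ((((γA⁻¹ : GL n finAdeleQ) : Matrix n n finAdeleQ)) *
      (a : Matrix n n finAdeleQ)) i j, ← Matrix.mulVec_mulVec, ← hx, hx_split, Matrix.mulVec_add, Pi.add_apply]
    exact add_mem (hγk i) (hγy i)
  · -- `a⁻¹ γ` is integral: its columns are `a⁻¹ (γ eⱼ)` with `γ eⱼ ∈ Λ_γ = Λ_a`
    have hcol : (γ : Matrix n n ℚ) *ᵥ (Pi.single j 1 : n → ℚ) ∈ latticeOfGL a := by
      rw [h, ← mul_one γA, hγA]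
      exact mulVec_mem_latticeOfGL_map_mul γ (mem_latticeOfGL_one_iff.mpr fun i => ⟨(Pi.single j 1 : n → ℤ) i, by
        by_cases hij : i = j
        · subst hij; simp
        · simp [hij]⟩)
    have e : (((γA⁻¹ * a)⁻¹ : GL n finAdeleQ) : Matrix n n finAdeleQ) i j =
        (((a⁻¹ : GL n finAdeleQ) : Matrix n n finAdeleQ) *ᵥ
          (⇑(algebraMap ℚ finAdeleQ) ∘ ((γ : Matrix n n ℚ) *ᵥ (Pi.single j 1 : n → ℚ)))) i := by
      rw [_root_.mul_inv_rev, inv_inv, Units.val_mul, matrix_apply_eq_mulVec_single ((((a⁻¹ : GL n finAdeleQ) :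
        Matrix n n finAdeleQ)) * (γA : Matrix n n finAdeleQ)) i j, ← Matrix.mulVec_mulVec, algebraMap_comp_mulVec,
        algebraMap_comp_single]
      rfl
    rw [e]
    exact hcol i

/-- **`GL_n(𝔸_{ℚ,f}) = GL_n(ℚ) · GL_n(ℤ̂)`** (class number one of `GL_n` over `ℚ`): every `a` is `γ u` with
`γ ∈ GL_n(ℚ)`, `u ∈ GL_n(ℤ̂)`, and then `Λ_a = γ ℤⁿ`. [cite: PlatonovRapinchuk1994, §8.1]
[cite: Milne2005ShimuraVarieties, §4 Thm. 4.16 and Rem. 4.17 (a) p. 48] -/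
theorem exists_map_mul_eq (a : GL n finAdeleQ) :
    ∃ (γ : GL n ℚ) (u : GL n finAdeleQ),
      u ∈ ((integralFiniteAdeles ℚ).matrix.toSubmonoid.units : Subgroup (GL n finAdeleQ)) ∧
        Matrix.GeneralLinearGroup.map (algebraMap ℚ finAdeleQ) γ * u = a ∧
          latticeOfGL a = latticeOfGL (Matrix.GeneralLinearGroup.map (algebraMap ℚ finAdeleQ) γ) := by
  obtain ⟨γ, hγ⟩ := exists_latticeOfGL_eq_latticeOfGL_map a
  exact ⟨γ, _, inv_mul_mem_of_latticeOfGL_eq hγ, mul_inv_cancel_left _ _, hγ⟩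

/-- **`Λ_a = Λ_b ↔ a⁻¹ b ∈ GL_n(ℤ̂)`**: the lattice map identifies `GL_n(𝔸_{ℚ,f}) / GL_n(ℤ̂)` with the full
lattices of `ℚⁿ`. [cite: PlatonovRapinchuk1994, §8.1] [cite: Milne2005ShimuraVarieties, §6 Thm. 6.11 p. 74 and p. 75] -/
theorem latticeOfGL_eq_latticeOfGL_iff (a b : GL n finAdeleQ) :
    latticeOfGL a = latticeOfGL b ↔
      a⁻¹ * b ∈ ((integralFiniteAdeles ℚ).matrix.toSubmonoid.units : Subgroup (GL n finAdeleQ)) := by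
  constructor
  · intro hab
    obtain ⟨γ, hγ⟩ := exists_latticeOfGL_eq_latticeOfGL_map a
    have ha := inv_mul_mem_of_latticeOfGL_eq hγ
    have hb := inv_mul_mem_of_latticeOfGL_eq (hab ▸ hγ)
    have := Subgroup.mul_mem _ (Subgroup.inv_mem _ ha) hb
    rwa [_root_.mul_inv_rev, inv_inv, mul_assoc, mul_inv_cancel_left] at this
  · intro h
    rw [← mul_inv_cancel_left a b, latticeOfGL_mul_eq_of_mem a h]

/-- **Stabiliser of `Λ_a` in `GL_n(ℚ)`**: `γ • Λ_a = Λ_a ↔ a⁻¹ γ a ∈ GL_n(ℤ̂)` («`Γ = G(ℚ) ∩ a K a⁻¹`» for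
`K = GL_n(ℤ̂)`). [cite: Milne2005ShimuraVarieties, §5 Lemma 5.13 p. 57] -/
theorem latticeOfGL_map_mul_eq_iff (γ : GL n ℚ) (a : GL n finAdeleQ) :
    latticeOfGL (Matrix.GeneralLinearGroup.map (algebraMap ℚ finAdeleQ) γ * a) = latticeOfGL a ↔
      a⁻¹ * Matrix.GeneralLinearGroup.map (algebraMap ℚ finAdeleQ) γ * a ∈
        ((integralFiniteAdeles ℚ).matrix.toSubmonoid.units : Subgroup (GL n finAdeleQ)) := by
  rw [latticeOfGL_eq_latticeOfGL_iff, _root_.mul_inv_rev, ← Subgroup.inv_mem_iff, _root_.mul_inv_rev,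
    _root_.mul_inv_rev, inv_inv, inv_inv, mul_assoc]


end Literature.NumberTheory.Adeles

end
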